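import Literature.NumberTheory.Automorphic.SymplecticSimilitudeSatakeCountingImage
import Literature.NumberTheory.Automorphic.SymplecticSatakeModP
import Literature.NumberTheory.Automorphic.SymplecticSimilitudeHeckeAlgebraStructure
import HarnessLib

/-!
# The mod-`p` Satake isomorphism for `GSp_{2n}` (Herzig Thm. 1.2 / Cor. 1.3, Henniart–Vignéras Thm. 1.5, trivial weight, every rank):
# for every commutative ring `R` with `q = 0` in `R`, `𝒮_1 : ℋ(GSp_{2n}(K), GSp_{2n}(𝒪); R) ⥲ R[Λ⁺]`, `Λ⁺ ⊆ ℤⁿ × ℤ` the dominant cone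

Topic `NumberTheory/Automorphic`; namespace `Literature.NumberTheory.Automorphic.SymplecticCartan` (lane `lit-hodgefound`,
Track 2 foundations; seat `lit-hodgefound-p11`, generation 51, row g51-#11).  DEFINITIONS with bodies (`similitudeDominantCone n`, the
additive submonoid `Λ⁺ = {(μ, c) : μ₀ ≥ ⋯ ≥ μ_{n-1}, 2μ_i ≥ c}` of `ℤⁿ × ℤ`; `similitudeConeEmbedding`; `similitudeSatakeModPAlgEquiv`) +
theorems; no named fact, no instance, no notation.  The `GSp_{2n}` twin of `SymplecticSatakeModP` (g50-#12), on top of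
`SymplecticSimilitudeSatakeCountingImage` (g51-#6: `𝒮_1(ℋ_R) = 𝒯_R(q)`, `mem_similitudeTwistedTarget_iff_of_cast_eq_zero`) and the
`ρ`-maximality of dominant exponents of `Sp_{2n}` (`SymplecticSatakeOrbitSumBasis`, g50-#11), transported along `ν = 2μ - c·1`.

## The print and the mathematics

[Herzig2010] Thm. 1.2 / Cor. 1.3 (`G` unramified, `K` hyperspecial, trivial weight: the mod-`p` Satake transform is injective with
image the functions supported on the antidominant coweights; `ℋ ≅ k̄[X_*(S)_-]`, commutative noetherian); [HenniartVigneras2013]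
Thm. 1.5 (any `C` of characteristic `p`).  HERE `G = GSp_{2n}(K)`, any non-archimedean `K` with compact `𝒪`, any commutative
`R` with `q = #𝓀 = 0` in `R`, in the tree's DOMINANT convention for `GSp_{2n}` (`(a, c)` dominant iff `a` antitone and
`2a_i ≥ c`, g51-#4).  (1) ρ-MAXIMALITY (`symplecticRhoPairing_fst_similitudeSignedPermEquiv_le`, `similitudeSignedPermEquiv_eq_self_of_le`):
for `(a, c)` dominant and `w ∈ W(GSp_{2n})`, `⟨ρ, (w(a,c))₁⟩ ≤ ⟨ρ, a⟩` with equality iff `w(a,c) = (a,c)` — transported from the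
`Sp_{2n}` statement for `ν = 2a - c·1` (antitone, `≥ 0`), since `2·(w_{(ε,π)}(a,c))₁ = (ε_i ν_{π i})_i + c·1` and
`2⟨ρ, μ⟩ = ⟨ρ, 2μ - c·1⟩ + c⟨ρ, 1⟩`.  (2) Every `(μ, c)` has a dominant `W`-conjugate (`exists_dominant_similitudeSignedPermEquiv`,
the head-sum maximum of the orbit, g51-#4).  (3) Hence for `b = 0` in `R`: `f ∈ 𝒯_R(b)` iff `supp f ⊆ Λ⁺`
(`mem_similitudeTwistedTarget_iff_forall_dominant_of_cast_eq_zero`), and with g51-#6: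
**`f ∈ 𝒮_1(ℋ_R) ⟺ supp f ⊆ Λ⁺`**, **`ℋ(GSp_{2n}(K), GSp_{2n}(𝒪); R) ≃ₐ[R] R[Λ⁺]`** (`similitudeSatakeModPAlgEquiv`); and `ℋ_R` is
noetherian for noetherian `R` (from `ℋ_R ≅ R[X_0, …, X_n][X_n⁻¹]`, `SymplecticSimilitudeHeckeAlgebraStructure`).

## What is formalised

* §1 `symplecticRhoPairing_two_mul`, `symplecticRhoPairing_const_mul_one`, `two_mul_fst_similitudeSignedPermEquiv`,
  **`symplecticRhoPairing_fst_similitudeSignedPermEquiv_le`**, **`similitudeSignedPermEquiv_eq_self_of_le`** ((1)),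
  **`exists_dominant_similitudeSignedPermEquiv`** ((2)), `symplecticRhoPairing_le_of_dominant_similitudeSignedPermEquiv`.
* §2 **`mem_similitudeTwistedTarget_iff_forall_dominant_of_cast_eq_zero`** ((3)).
* §3 `similitudeDominantCone n` (+ `mem_…_iff`), `similitudeConeEmbedding R n` (+ `_apply`, `_single`, `_injective`, `mem_range_…_iff`).
* §4 **`antitone_two_mul_ge_of_coeff_similitudeSatakeTransform_one_ne_zero`** (THM. 1.2, support half),
  **`mem_range_similitudeSatakeTransform_one_iff_of_cast_eq_zero`**, `single_mem_range_similitudeSatakeTransform_one`,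
  `mem_range_similitudeSatakeTransform_one_iff_of_charP`, `range_similitudeSatakeTransform_one_eq_range_similitudeConeEmbedding`,
  **`similitudeSatakeModPAlgEquiv hϖ hq : ℋ(GSp_{2n}(K), GSp_{2n}(𝒪); R) ≃ₐ[R] R[Λ⁺]`** (COR. 1.3) + `similitudeConeEmbedding_similitudeSatakeModPAlgEquiv`,
  `isNoetherianRing_heckeAlgebra_symplecticSimilitudeInt` (COR. 1.3 «noetherian», every noetherian `R`).

## References
* [Herzig2010] F. Herzig, *A Satake isomorphism in characteristic p*, Compositio Math. 147 (2011) 263–283, Thm. 1.2, Cor. 1.3, §1.2.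
* [HenniartVigneras2013] G. Henniart, M.-F. Vignéras, *A Satake isomorphism for representations modulo p of reductive groups over
  local fields*, J. reine angew. Math. 701 (2015) 33–75, Thm. 1.5, §7.15.
* [ZhuIntegralSatake2020] X. Zhu, *A note on integral Satake isomorphisms*, arXiv:2005.13056, §1.4.
* [AndrianovZhuravlev1995] A. N. Andrianov, V. G. Zhuravlev, *Modular Forms and Hecke Operators* (1995), Ch. 3 §3.3 (3.51), Thm. 3.30.
-/

noncomputable section

open scoped Valued WithZero MatrixGroups
open MonoidAlgebra Representation

namespace Literature.NumberTheory.Automorphic.SymplecticCartan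

open Literature.NumberTheory.Automorphic Literature.NumberTheory.Automorphic.CartanUnique
  Literature.NumberTheory.Automorphic.HermitianLattice

variable {R : Type*} [CommRing R] {n : ℕ}

/-! ## §1 `ρ`-maximality of the dominant similitude exponents -/

/-- `⟨ρ, 2μ⟩ = 2⟨ρ, μ⟩`. [cite: CartierCorvallis1979, §IV (4.2)] -/
theorem symplecticRhoPairing_two_mul (x : Fin n → ℤ) :
    symplecticRhoPairing (fun i => 2 * x i) = 2 * symplecticRhoPairing x := by
  rw [show (fun i => 2 * x i) = x + x from funext fun i => by rw [Pi.add_apply, two_mul], symplecticRhoPairing_add, two_mul]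

/-- `⟨ρ, c·1⟩ = c ⟨ρ, 1⟩`. [cite: CartierCorvallis1979, §IV (4.2)] -/
theorem symplecticRhoPairing_const_mul_one (c : ℤ) :
    symplecticRhoPairing (fun _ : Fin n => c) = c * symplecticRhoPairing (fun _ : Fin n => (1 : ℤ)) := by
  unfold symplecticRhoPairing
  rw [Finset.mul_sum]
  exact Finset.sum_congr rfl fun i _ => by ring

/-- **The shift `ν = 2μ - c·1` intertwines `W(GSp_{2n})` with the signed permutations**: `2·(w_{(ε,π)}λ)₁ = (ε_i ν_{π i})_i + c·1`
for `λ = (μ, c)`, `ν = 2μ - c·1`. [cite: AndrianovZhuravlev1995, Ch. 3 §3.3 (3.51)] -/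
theorem two_mul_fst_similitudeSignedPermEquiv (ε : Fin n → ℤˣ) (π : Equiv.Perm (Fin n)) (lc : (Fin n → ℤ) × ℤ) :
    (fun i => 2 * (similitudeSignedPermEquiv ε π lc).1 i) =
      (fun i => (ε i : ℤ) * (2 * lc.1 (π i) - lc.2)) + fun _ => lc.2 := by
  funext i
  rw [similitudeSignedPermEquiv_apply, Pi.add_apply]
  dsimp only
  rcases Int.units_eq_one_or (ε i) with h | h
  · rw [if_pos h, h, Units.val_one]; ring
  · rw [if_neg (by rw [h]; decide), h, Units.val_neg, Units.val_one]; ring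

/-- **`ρ`-MAXIMALITY OF DOMINANT EXPONENTS OF `GSp_{2n}`**: for `λ = (a, c)` dominant (`a` antitone, `2a_i ≥ c`) and every
`w ∈ W(GSp_{2n})`, `⟨ρ, (wλ)₁⟩ ≤ ⟨ρ, a⟩` (the modulus is largest on the dominant element of each orbit; transported from
`Sp_{2n}` along `ν = 2a - c·1`). [cite: Herzig2010, §1.2] [cite: AndrianovZhuravlev1995, Ch. 3 §3.3 (3.51)] -/
theorem symplecticRhoPairing_fst_similitudeSignedPermEquiv_le {lc : (Fin n → ℤ) × ℤ} (ha : Antitone lc.1)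
    (hc : ∀ i, lc.2 ≤ 2 * lc.1 i) (ε : Fin n → ℤˣ) (π : Equiv.Perm (Fin n)) :
    symplecticRhoPairing (similitudeSignedPermEquiv ε π lc).1 ≤ symplecticRhoPairing lc.1 := by
  have hνa : Antitone (fun j => 2 * lc.1 j - lc.2) := fun i j hij => by dsimp only; linarith [ha hij]
  have hν0 : ∀ i, 0 ≤ (fun j => 2 * lc.1 j - lc.2) i := fun i => by dsimp only; linarith [hc i]
  have h1 : 2 * symplecticRhoPairing (similitudeSignedPermEquiv ε π lc).1 =
      symplecticRhoPairing (fun i => (ε i : ℤ) * (2 * lc.1 (π i) - lc.2)) + lc.2 * symplecticRhoPairing (fun _ : Fin n => (1 : ℤ)) := by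
    rw [← symplecticRhoPairing_two_mul, two_mul_fst_similitudeSignedPermEquiv, symplecticRhoPairing_add, symplecticRhoPairing_const_mul_one]
  have h2 : 2 * symplecticRhoPairing lc.1 =
      symplecticRhoPairing (fun j => 2 * lc.1 j - lc.2) + lc.2 * symplecticRhoPairing (fun _ : Fin n => (1 : ℤ)) := by
    rw [← symplecticRhoPairing_two_mul, show (fun i => 2 * lc.1 i) = (fun j => 2 * lc.1 j - lc.2) + fun _ => lc.2 from
      funext fun i => by rw [Pi.add_apply]; ring, symplecticRhoPairing_add, symplecticRhoPairing_const_mul_one]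
  have h3 : symplecticRhoPairing (fun i => (ε i : ℤ) * (2 * lc.1 (π i) - lc.2)) ≤ symplecticRhoPairing (fun j => 2 * lc.1 j - lc.2) :=
    symplecticRhoPairing_signedPerm_le hνa hν0 ε π
  linarith

/-- **Equality case**: if `⟨ρ, a⟩ ≤ ⟨ρ, (wλ)₁⟩` for a dominant `λ = (a, c)`, then `wλ = λ` — the dominant element is the UNIQUE
`⟨ρ,·⟩`-maximum of its `W(GSp_{2n})`-orbit. [cite: Herzig2010, §1.2] [cite: AndrianovZhuravlev1995, Ch. 3 §3.3 (3.51)] -/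
theorem similitudeSignedPermEquiv_eq_self_of_le {lc : (Fin n → ℤ) × ℤ} (ha : Antitone lc.1) (hc : ∀ i, lc.2 ≤ 2 * lc.1 i)
    (ε : Fin n → ℤˣ) (π : Equiv.Perm (Fin n))
    (h : symplecticRhoPairing lc.1 ≤ symplecticRhoPairing (similitudeSignedPermEquiv ε π lc).1) :
    similitudeSignedPermEquiv ε π lc = lc := by
  have hνa : Antitone (fun j => 2 * lc.1 j - lc.2) := fun i j hij => by dsimp only; linarith [ha hij]
  have hν0 : ∀ i, 0 ≤ (fun j => 2 * lc.1 j - lc.2) i := fun i => by dsimp only; linarith [hc i]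
  have h1 : 2 * symplecticRhoPairing (similitudeSignedPermEquiv ε π lc).1 =
      symplecticRhoPairing (fun i => (ε i : ℤ) * (2 * lc.1 (π i) - lc.2)) + lc.2 * symplecticRhoPairing (fun _ : Fin n => (1 : ℤ)) := by
    rw [← symplecticRhoPairing_two_mul, two_mul_fst_similitudeSignedPermEquiv, symplecticRhoPairing_add, symplecticRhoPairing_const_mul_one]
  have h2 : 2 * symplecticRhoPairing lc.1 =
      symplecticRhoPairing (fun j => 2 * lc.1 j - lc.2) + lc.2 * symplecticRhoPairing (fun _ : Fin n => (1 : ℤ)) := by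
    rw [← symplecticRhoPairing_two_mul, show (fun i => 2 * lc.1 i) = (fun j => 2 * lc.1 j - lc.2) + fun _ => lc.2 from
      funext fun i => by rw [Pi.add_apply]; ring, symplecticRhoPairing_add, symplecticRhoPairing_const_mul_one]
  have hfix : (fun i => (ε i : ℤ) * (2 * lc.1 (π i) - lc.2)) = fun j => 2 * lc.1 j - lc.2 :=
    signedPerm_eq_self_of_le hνa hν0 ε π (by linarith)
  have hcomp := two_mul_fst_similitudeSignedPermEquiv ε π lc
  refine Prod.ext (funext fun i => ?_) (snd_similitudeSignedPermEquiv ε π lc)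
  have hi : 2 * (similitudeSignedPermEquiv ε π lc).1 i = (ε i : ℤ) * (2 * lc.1 (π i) - lc.2) + lc.2 := congrFun hcomp i
  have hfi : (ε i : ℤ) * (2 * lc.1 (π i) - lc.2) = 2 * lc.1 i - lc.2 := congrFun hfix i
  change (similitudeSignedPermEquiv ε π lc).1 i = lc.1 i
  linarith

/-- **Every similitude exponent has a DOMINANT `W(GSp_{2n})`-conjugate** (the head-sum maximum of its finite orbit).
[cite: CartierCorvallis1979, §IV, proof of Thm. 4.1 (c)] [cite: AndrianovZhuravlev1995, Ch. 3 §3.3 (3.51)] -/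
theorem exists_dominant_similitudeSignedPermEquiv (lc : (Fin n → ℤ) × ℤ) :
    ∃ (ε : Fin n → ℤˣ) (π : Equiv.Perm (Fin n)),
      Antitone (similitudeSignedPermEquiv ε π lc).1 ∧ ∀ i, lc.2 ≤ 2 * (similitudeSignedPermEquiv ε π lc).1 i := by
  classical
  set S : Finset (Fin n → ℤ) := Finset.univ.image
    fun p : (Fin n → ℤˣ) × Equiv.Perm (Fin n) => (similitudeSignedPermEquiv p.1 p.2 lc).1 with hSdef
  have hmemS : ∀ ν, ν ∈ S ↔ ∃ (ε : Fin n → ℤˣ) (π : Equiv.Perm (Fin n)), (similitudeSignedPermEquiv ε π lc).1 = ν := fun ν => by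
    rw [hSdef, Finset.mem_image]
    exact ⟨fun ⟨p, _, hp⟩ => ⟨p.1, p.2, hp⟩, fun ⟨ε, π, h⟩ => ⟨(ε, π), Finset.mem_univ _, h⟩⟩
  have hstab : ∀ ν ∈ S, ∀ (ε : Fin n → ℤˣ) (π : Equiv.Perm (Fin n)), (similitudeSignedPermEquiv ε π (ν, lc.2)).1 ∈ S := by
    intro ν hν ε π
    obtain ⟨ε', π', rfl⟩ := (hmemS ν).1 hν
    refine (hmemS _).2 ⟨fun i => ε i * ε' (π i), π' * π, ?_⟩
    rw [← similitudeSignedPermEquiv_mul, LinearEquiv.mul_apply]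
    rfl
  have hμS : lc.1 ∈ S := (hmemS lc.1).2 ⟨fun _ => 1, 1, by rw [similitudeSignedPermEquiv_one]; rfl⟩
  obtain ⟨a, haS, hmax⟩ := S.exists_max_image (fun ν => toLex (headSumVec ν)) ⟨lc.1, hμS⟩
  obtain ⟨ε, π, rfl⟩ := (hmemS a).1 haS
  exact ⟨ε, π, antitone_two_mul_ge_of_isMaxOn_headSumVec hstab haS hmax⟩

/-- `⟨ρ, μ⟩ ≤ ⟨ρ, (wλ)₁⟩` for `λ = (μ, c)` and its dominant conjugate `wλ`. [cite: Herzig2010, §1.2] -/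
theorem symplecticRhoPairing_le_of_dominant_similitudeSignedPermEquiv {lc : (Fin n → ℤ) × ℤ} {ε : Fin n → ℤˣ} {π : Equiv.Perm (Fin n)}
    (ha : Antitone (similitudeSignedPermEquiv ε π lc).1) (hc : ∀ i, lc.2 ≤ 2 * (similitudeSignedPermEquiv ε π lc).1 i) :
    symplecticRhoPairing lc.1 ≤ symplecticRhoPairing (similitudeSignedPermEquiv ε π lc).1 := by
  have h := symplecticRhoPairing_fst_similitudeSignedPermEquiv_le (lc := similitudeSignedPermEquiv ε π lc) ha hc
    (fun j => ε (π.symm j)) π.symm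
  rwa [similitudeSignedPermEquiv_symm_apply'] at h

/-! ## §2 The twisted invariants at `b = 0`: functions supported on the dominant cone -/

/-- **`𝒯_R(b) = R[Λ⁺]` when `b = 0` in `R`**: `f ∈ 𝒯_R(b)` iff every exponent `(μ, c)` of `f` is dominant (`μ` antitone,
`2μ_i ≥ c`). [cite: Herzig2010, Thm. 1.2, §1.2] [cite: HenniartVigneras2013, Thm. 1.5 (ii), §7.15 Remark 1] -/
theorem mem_similitudeTwistedTarget_iff_forall_dominant_of_cast_eq_zero {b : ℕ} (hb : (b : R) = 0)
    (f : AddMonoidAlgebra R ((Fin n → ℤ) × ℤ)) :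
    f ∈ similitudeTwistedTarget R n b ↔
      ∀ lc : (Fin n → ℤ) × ℤ, f.coeff lc ≠ 0 → Antitone lc.1 ∧ ∀ i, lc.2 ≤ 2 * lc.1 i := by
  constructor
  · intro hf lc hμ
    obtain ⟨ε, π, ha, hc⟩ := exists_dominant_similitudeSignedPermEquiv lc
    have hback : similitudeSignedPermEquiv (fun j => ε (π.symm j)) π.symm (similitudeSignedPermEquiv ε π lc) = lc :=
      similitudeSignedPermEquiv_symm_apply' ε π lc
    have hle : symplecticRhoPairing lc.1 ≤ symplecticRhoPairing (similitudeSignedPermEquiv ε π lc).1 :=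
      symplecticRhoPairing_le_of_dominant_similitudeSignedPermEquiv ha hc
    by_cases heq : symplecticRhoPairing lc.1 = symplecticRhoPairing (similitudeSignedPermEquiv ε π lc).1
    · have h := similitudeSignedPermEquiv_eq_self_of_le (lc := similitudeSignedPermEquiv ε π lc) ha hc
        (fun j => ε (π.symm j)) π.symm (by rw [hback]; exact heq.ge)
      rw [hback] at h
      rw [h]
      exact ⟨ha, hc⟩
    · have hlt : symplecticRhoPairing lc.1 < symplecticRhoPairing (similitudeSignedPermEquiv ε π lc).1 := lt_of_le_of_ne hle heq
      have hzero := ((mem_similitudeTwistedTarget_iff_of_cast_eq_zero hb f).1 hf (similitudeSignedPermEquiv ε π lc)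
        (fun j => ε (π.symm j)) π.symm).1
      rw [hback] at hzero
      exact absurd (hzero hlt) hμ
  · intro h
    rw [mem_similitudeTwistedTarget_iff_of_cast_eq_zero hb]
    intro lc ε π
    have hback : similitudeSignedPermEquiv (fun j => ε (π.symm j)) π.symm (similitudeSignedPermEquiv ε π lc) = lc :=
      similitudeSignedPermEquiv_symm_apply' ε π lc
    -- if `w λ` is an exponent of `f` then `⟨ρ, λ₁⟩ ≤ ⟨ρ, (wλ)₁⟩`, with equality only if `wλ = λ`
    have key : f.coeff (similitudeSignedPermEquiv ε π lc) ≠ 0 →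
        symplecticRhoPairing lc.1 ≤ symplecticRhoPairing (similitudeSignedPermEquiv ε π lc).1 ∧
          (symplecticRhoPairing (similitudeSignedPermEquiv ε π lc).1 ≤ symplecticRhoPairing lc.1 →
            similitudeSignedPermEquiv ε π lc = lc) := by
      intro hne
      obtain ⟨hd1, hd2⟩ := h _ hne
      refine ⟨symplecticRhoPairing_le_of_dominant_similitudeSignedPermEquiv hd1 hd2, fun hle => ?_⟩
      have h2 := similitudeSignedPermEquiv_eq_self_of_le (lc := similitudeSignedPermEquiv ε π lc) hd1 hd2
        (fun j => ε (π.symm j)) π.symm (by rw [hback]; exact hle)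
      rw [hback] at h2
      exact h2.symm
    constructor
    · intro hlt
      by_contra hne
      exact absurd hlt (not_lt.2 (key hne).1)
    · intro heq
      by_cases hne : f.coeff (similitudeSignedPermEquiv ε π lc) = 0
      · by_cases hlc : f.coeff lc = 0
        · rw [hne, hlc]
        · obtain ⟨hd1, hd2⟩ := h _ hlc
          rw [similitudeSignedPermEquiv_eq_self_of_le hd1 hd2 ε π heq.ge]
      · rw [(key hne).2 heq.le]

/-! ## §3 The dominant cone `Λ⁺ ⊆ ℤⁿ × ℤ` and `R[Λ⁺] ⊆ R[ℤⁿ × ℤ]` -/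

variable (n) in
/-- **The dominant cone `Λ⁺ = {(μ, c) : μ₀ ≥ μ₁ ≥ ⋯ ≥ μ_{n-1}, 2μ_i ≥ c}`** of `GSp_{2n}`, an additive submonoid of `ℤⁿ × ℤ` (the
tree's indexing of the Cartan representatives `t(c, μ - c·1)`). [cite: Herzig2010, Def. 1.1, Cor. 1.3] [cite: AndrianovZhuravlev1995, Ch. 3 §3.3 Lemma 3.6] -/
def similitudeDominantCone : AddSubmonoid ((Fin n → ℤ) × ℤ) where
  carrier := {lc | Antitone lc.1 ∧ ∀ i, lc.2 ≤ 2 * lc.1 i}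
  add_mem' {x y} hx hy := ⟨hx.1.add hy.1, fun i => by
    rw [Prod.snd_add, Prod.fst_add, Pi.add_apply]
    linarith [hx.2 i, hy.2 i]⟩
  zero_mem' := ⟨antitone_const, fun _ => le_rfl⟩

/-- Membership in `Λ⁺`. [cite: Herzig2010, Def. 1.1] -/
theorem mem_similitudeDominantCone_iff (lc : (Fin n → ℤ) × ℤ) :
    lc ∈ similitudeDominantCone n ↔ Antitone lc.1 ∧ ∀ i, lc.2 ≤ 2 * lc.1 i := Iff.rfl

variable (R n) in
/-- **`R[Λ⁺] →ₐ[R] R[ℤⁿ × ℤ]`**, the inclusion of the monoid algebra of the dominant cone. [cite: Herzig2010, Cor. 1.3] -/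
def similitudeConeEmbedding : AddMonoidAlgebra R (similitudeDominantCone n) →ₐ[R] AddMonoidAlgebra R ((Fin n → ℤ) × ℤ) :=
  AddMonoidAlgebra.mapDomainAlgHom R R (similitudeDominantCone n).subtype

/-- `similitudeConeEmbedding` is `mapDomain` along the inclusion. [cite: Herzig2010, Cor. 1.3] -/
theorem similitudeConeEmbedding_apply (g : AddMonoidAlgebra R (similitudeDominantCone n)) :
    similitudeConeEmbedding R n g = AddMonoidAlgebra.mapDomain ((↑) : similitudeDominantCone n → (Fin n → ℤ) × ℤ) g := rfl

/-- `similitudeConeEmbedding (x^c) = x^c`. [cite: Herzig2010, Cor. 1.3] -/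
theorem similitudeConeEmbedding_single (c : similitudeDominantCone n) (r : R) :
    similitudeConeEmbedding R n (AddMonoidAlgebra.single c r) = AddMonoidAlgebra.single (c : (Fin n → ℤ) × ℤ) r := by
  rw [similitudeConeEmbedding_apply, AddMonoidAlgebra.mapDomain_single]

/-- The inclusion `R[Λ⁺] → R[ℤⁿ × ℤ]` is injective. [cite: Herzig2010, Cor. 1.3] -/
theorem similitudeConeEmbedding_injective : Function.Injective (similitudeConeEmbedding R n) := by
  intro g g' h
  rw [similitudeConeEmbedding_apply, similitudeConeEmbedding_apply] at h
  exact AddMonoidAlgebra.mapDomain_injective Subtype.val_injective h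

/-- **`range (R[Λ⁺] → R[ℤⁿ × ℤ])` = the functions supported on `Λ⁺`.** [cite: Herzig2010, Thm. 1.2] -/
theorem mem_range_similitudeConeEmbedding_iff (f : AddMonoidAlgebra R ((Fin n → ℤ) × ℤ)) :
    f ∈ (similitudeConeEmbedding R n).range ↔
      ∀ lc : (Fin n → ℤ) × ℤ, f.coeff lc ≠ 0 → Antitone lc.1 ∧ ∀ i, lc.2 ≤ 2 * lc.1 i := by
  classical
  constructor
  · rintro ⟨g, rfl⟩ lc hlc
    change (AddMonoidAlgebra.mapDomain ((↑) : similitudeDominantCone n → (Fin n → ℤ) × ℤ) g).coeff lc ≠ 0 at hlc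
    rw [AddMonoidAlgebra.coeff_mapDomain] at hlc
    have hs := Finsupp.mapDomain_support (f := ((↑) : similitudeDominantCone n → (Fin n → ℤ) × ℤ)) (s := g.coeff)
      (Finsupp.mem_support_iff.2 hlc)
    obtain ⟨c, -, rfl⟩ := Finset.mem_image.1 hs
    exact c.2
  · intro h
    have hsupp : ↑f.coeff.support ⊆ Set.range ((↑) : similitudeDominantCone n → (Fin n → ℤ) × ℤ) := by
      intro lc hlc
      exact ⟨⟨lc, h lc (Finsupp.mem_support_iff.1 hlc)⟩, rfl⟩
    refine ⟨AddMonoidAlgebra.ofCoeff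
      (Finsupp.comapDomain ((↑) : similitudeDominantCone n → (Fin n → ℤ) × ℤ) f.coeff Subtype.val_injective.injOn), ?_⟩
    change AddMonoidAlgebra.mapDomain ((↑) : similitudeDominantCone n → (Fin n → ℤ) × ℤ) _ = f
    refine AddMonoidAlgebra.coeff_injective ?_
    rw [AddMonoidAlgebra.coeff_mapDomain, AddMonoidAlgebra.coeff_ofCoeff]
    exact Finsupp.mapDomain_comapDomain _ Subtype.val_injective f.coeff hsupp

/-! ## §4 The mod-`p` Satake isomorphism for `GSp_{2n}` -/

section Hecke

variable {K : Type*} [Field K] [Valued K ℤᵐ⁰] {ϖ : K} [NeZero n] [CompactSpace 𝒪[K]] [Finite 𝓀[K]]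
  [IsHeckeTriple (⊤ : Submonoid (symplecticSimilitudeGroup (Fin n) K)) (symplecticSimilitudeInt (Fin n) K)
    (symplecticSimilitudeInt (Fin n) K)]

/-- **HERZIG'S THEOREM 1.2 FOR `GSp_{2n}`, SUPPORT HALF: when `q = 0` in `R`, every exponent of `𝒮_1(T)` is dominant**, for every
`T ∈ ℋ(GSp_{2n}(K), GSp_{2n}(𝒪); R)`. [cite: Herzig2010, Thm. 1.2, §1.2] [cite: HenniartVigneras2013, Thm. 1.5 (ii)] -/
theorem antitone_two_mul_ge_of_coeff_similitudeSatakeTransform_one_ne_zero (hϖ : Valued.v ϖ = WithZero.exp (-1 : ℤ))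
    (hq : ((Nat.card 𝓀[K] : ℕ) : R) = 0)
    (T : heckeAlgebra R (symplecticSimilitudeGroup (Fin n) K) (symplecticSimilitudeInt (Fin n) K))
    {lc : (Fin n → ℤ) × ℤ} (hlc : (similitudeSatakeTransform hϖ 1 T).coeff lc ≠ 0) : Antitone lc.1 ∧ ∀ i, lc.2 ≤ 2 * lc.1 i :=
  (mem_similitudeTwistedTarget_iff_forall_dominant_of_cast_eq_zero hq _).1 (similitudeSatakeTransform_one_mem_twisted hϖ T) lc hlc

/-- **HERZIG'S THEOREM 1.2 / HENNIART–VIGNÉRAS' THEOREM 1.5 FOR `GSp_{2n}` (trivial weight), OVER EVERY COMMUTATIVE RING `R` WITH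
`q = 0` IN `R`**: `f ∈ R[ℤⁿ × ℤ]` is `𝒮_1(T)` for some `T ∈ ℋ(GSp_{2n}(K), GSp_{2n}(𝒪); R)` iff every exponent of `f` is dominant —
`𝒮_1(ℋ_R) = R[Λ⁺]`. [cite: Herzig2010, Thm. 1.2] [cite: HenniartVigneras2013, Thm. 1.5 (ii), §7.15] -/
theorem mem_range_similitudeSatakeTransform_one_iff_of_cast_eq_zero (hϖ : Valued.v ϖ = WithZero.exp (-1 : ℤ))
    (hq : ((Nat.card 𝓀[K] : ℕ) : R) = 0) (f : AddMonoidAlgebra R ((Fin n → ℤ) × ℤ)) :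
    f ∈ (similitudeSatakeTransform (n := n) (K := K) hϖ (1 : Rˣ)).range ↔
      ∀ lc : (Fin n → ℤ) × ℤ, f.coeff lc ≠ 0 → Antitone lc.1 ∧ ∀ i, lc.2 ≤ 2 * lc.1 i := by
  rw [← mem_similitudeTwistedTarget_iff_forall_dominant_of_cast_eq_zero hq, ← range_similitudeSatakeTransform_one_eq_twisted hϖ,
    AlgHom.mem_range, LinearMap.mem_range]
  rfl

/-- **Every dominant monomial is a transform when `q = 0` in `R`**: `x^{(μ,c)} ∈ 𝒮_1(ℋ_R)` for `(μ, c) ∈ Λ⁺`.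
[cite: HenniartVigneras2013, §7.15 Remark 1] [cite: Herzig2010, Thm. 1.2] -/
theorem single_mem_range_similitudeSatakeTransform_one (hϖ : Valued.v ϖ = WithZero.exp (-1 : ℤ))
    (hq : ((Nat.card 𝓀[K] : ℕ) : R) = 0) {lc : (Fin n → ℤ) × ℤ} (hlc : Antitone lc.1 ∧ ∀ i, lc.2 ≤ 2 * lc.1 i) :
    AddMonoidAlgebra.single lc (1 : R) ∈ (similitudeSatakeTransform (n := n) (K := K) hϖ (1 : Rˣ)).range := by
  classical
  rw [mem_range_similitudeSatakeTransform_one_iff_of_cast_eq_zero hϖ hq]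
  intro x hx
  rw [AddMonoidAlgebra.coeff_single, Finsupp.single_apply] at hx
  by_cases h : lc = x
  · rw [← h]; exact hlc
  · exact absurd (if_neg h) hx

/-- **The mod-`p` Satake image in characteristic `p = char 𝓀`**: for every commutative ring `R` of characteristic `p`,
`f ∈ 𝒮_1(ℋ(GSp_{2n}(K), GSp_{2n}(𝒪); R))` iff every exponent of `f` is dominant. [cite: Herzig2010, Thm. 1.2]
[cite: HenniartVigneras2013, Thm. 1.5 (ii)] -/
theorem mem_range_similitudeSatakeTransform_one_iff_of_charP (hϖ : Valued.v ϖ = WithZero.exp (-1 : ℤ)) (p : ℕ) [CharP 𝓀[K] p]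
    [CharP R p] (f : AddMonoidAlgebra R ((Fin n → ℤ) × ℤ)) :
    f ∈ (similitudeSatakeTransform (n := n) (K := K) hϖ (1 : Rˣ)).range ↔
      ∀ lc : (Fin n → ℤ) × ℤ, f.coeff lc ≠ 0 → Antitone lc.1 ∧ ∀ i, lc.2 ≤ 2 * lc.1 i :=
  mem_range_similitudeSatakeTransform_one_iff_of_cast_eq_zero hϖ
    (HermitianLattice.UnramifiedLocalConjDatum.natCast_card_residueField_eq_zero_of_charP (K := K) (R := R) p) f

/-- `range 𝒮_1 = range (R[Λ⁺] → R[ℤⁿ × ℤ])` when `q = 0` in `R`. [cite: Herzig2010, Thm. 1.2] -/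
theorem range_similitudeSatakeTransform_one_eq_range_similitudeConeEmbedding (hϖ : Valued.v ϖ = WithZero.exp (-1 : ℤ))
    (hq : ((Nat.card 𝓀[K] : ℕ) : R) = 0) :
    (similitudeSatakeTransform (n := n) (K := K) hϖ (1 : Rˣ)).range = (similitudeConeEmbedding R n).range :=
  Subalgebra.ext fun f => by
    rw [mem_range_similitudeSatakeTransform_one_iff_of_cast_eq_zero hϖ hq, mem_range_similitudeConeEmbedding_iff]

/-- **HERZIG'S COROLLARY 1.3 FOR `GSp_{2n}`: `ℋ(GSp_{2n}(K), GSp_{2n}(𝒪); R) ≃ₐ[R] R[Λ⁺]` when `q = 0` in `R`** — the counting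
transform followed by the identification of its image with the monoid algebra of the dominant cone. [cite: Herzig2010, Cor. 1.3]
[cite: HenniartVigneras2013, Thm. 1.5, §7.15] -/
def similitudeSatakeModPAlgEquiv (hϖ : Valued.v ϖ = WithZero.exp (-1 : ℤ)) (hq : ((Nat.card 𝓀[K] : ℕ) : R) = 0) :
    heckeAlgebra R (symplecticSimilitudeGroup (Fin n) K) (symplecticSimilitudeInt (Fin n) K) ≃ₐ[R]
      AddMonoidAlgebra R (similitudeDominantCone n) :=
  ((AlgEquiv.ofInjective _ (similitudeSatakeTransform_injective_of_commRing hϖ (1 : Rˣ))).trans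
    (Subalgebra.equivOfEq _ _ (range_similitudeSatakeTransform_one_eq_range_similitudeConeEmbedding hϖ hq))).trans
    (AlgEquiv.ofInjective _ (similitudeConeEmbedding_injective (R := R) (n := n))).symm

/-- The mod-`p` isomorphism IS the counting transform: `similitudeConeEmbedding (e T) = 𝒮_1(T)`. [cite: Herzig2010, Cor. 1.3] -/
theorem similitudeConeEmbedding_similitudeSatakeModPAlgEquiv (hϖ : Valued.v ϖ = WithZero.exp (-1 : ℤ))
    (hq : ((Nat.card 𝓀[K] : ℕ) : R) = 0)
    (T : heckeAlgebra R (symplecticSimilitudeGroup (Fin n) K) (symplecticSimilitudeInt (Fin n) K)) :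
    similitudeConeEmbedding R n (similitudeSatakeModPAlgEquiv hϖ hq T) = similitudeSatakeTransform hϖ 1 T := by
  rw [similitudeSatakeModPAlgEquiv, AlgEquiv.trans_apply, AlgEquiv.trans_apply]
  set y := Subalgebra.equivOfEq _ _ (range_similitudeSatakeTransform_one_eq_range_similitudeConeEmbedding hϖ hq)
    (AlgEquiv.ofInjective _ (similitudeSatakeTransform_injective_of_commRing hϖ (1 : Rˣ)) T) with hy
  have h1 : (y : AddMonoidAlgebra R ((Fin n → ℤ) × ℤ)) = similitudeSatakeTransform hϖ 1 T := rfl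
  rw [← h1]
  exact congrArg Subtype.val ((AlgEquiv.ofInjective _ (similitudeConeEmbedding_injective (R := R) (n := n))).apply_symm_apply y)

omit [CompactSpace 𝒪[K]] [Finite 𝓀[K]] in
/-- **HERZIG'S COROLLARY 1.3 «In particular it is noetherian» FOR `GSp_{2n}`, over every noetherian commutative ring `R`**
(from `ℋ(GSp_{2n}(K), GSp_{2n}(𝒪); R) ≅ R[X_0, …, X_n][X_n⁻¹]`, `SymplecticSimilitudeHeckeAlgebraStructure`). [cite: Herzig2010, Cor. 1.3]
[cite: HenniartVigneras2013, §7.16] -/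
theorem isNoetherianRing_heckeAlgebra_symplecticSimilitudeInt [IsNoetherianRing R] (hϖ : Valued.v ϖ = WithZero.exp (-1 : ℤ)) :
    IsNoetherianRing (heckeAlgebra R (symplecticSimilitudeGroup (Fin n) K) (symplecticSimilitudeInt (Fin n) K)) := by
  obtain ⟨e, -⟩ := exists_algEquiv_heckeAlgebra_symplecticSimilitudeInt_localization (n := n) (R := R) hϖ
  haveI : IsNoetherianRing (Localization.Away (MvPolynomial.X (Fin.last n) : MvPolynomial (Fin (n + 1)) R)) :=
    IsLocalization.isNoetherianRing (Submonoid.powers (MvPolynomial.X (Fin.last n) : MvPolynomial (Fin (n + 1)) R)) _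
      inferInstance
  exact isNoetherianRing_of_ringEquiv _ e.symm.toRingEquiv

end Hecke

end Literature.NumberTheory.Automorphic.SymplecticCartan

end
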